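import Mathlib
import Summits.SmoothPoincare4.SmoothPoincare4.Theses.CylinderEntropy
import Summits.SmoothPoincare4.SmoothPoincare4.Theorems.CylinderEntropyRungTwoOfSurgeryResolution
import Summits.SmoothPoincare4.SmoothPoincare4.Theorems.CylinderEntropyThinCrossSectionExistsOfMassSlackUnconditional
import Summits.SmoothPoincare4.SmoothPoincare4.Theorems.ThinCrossSectionExists.Negative.FrameAnalysis
import Summits.SmoothPoincare4.SmoothPoincare4.Theorems.CylinderEntropySliceCalibration
import Summits.SmoothPoincare4.SmoothPoincare4.Theorems.CylinderEntropyCylinderRungTwoSliceOfCylEntropyLeOne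
import Literature.Geometry.Riemannian.SphericalCylinderEntropy
import Literature.Geometry.Manifold.CylinderSlice
import Literature.Geometry.Manifold.EmbeddingRangeDiffeomorph
import Literature.Topology.FourManifolds.CorkPresentationHomotopySphere
import Literature.Topology.FourManifolds.HomotopyS4CompactProofs
import Literature.Topology.FourManifolds.HomotopyS4OrientableProofs
import Literature.Topology.FourManifolds.HomotopyS4SimplyConnected
import Literature.Topology.FourManifolds.SphereSimplyConnected

/-!
# STRATEGY CENSUS (strategist s1, cone r2) — typed companion for crux E = `CylinderEntropy.ThinCrossSectionExists`
# (stmt-SmoothPoincare4-7633)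

**NOT A LINE.** No `stub_*`, no `ThinCrossSectionExists_of`, nothing registered, no `sorry`.  Crux-strategist artefact
accompanying `STRATEGY-CENSUS.md` (s1, written for the route's NEW cone `closes (hX : CylinderSurgeryResolution)
(hN : NearSliceRecognition) (hG : RungTwoOfSurgeryResolution) (hE : ThinCrossSectionExists)`, route file rev 8).
It supersedes nothing in `StrategyCensusSplits.lean` (strategist p1: splits A/B, closed threshold, isotopy form) and
re-uses its vocabulary; what is typed and kernel-checked HERE is new:

* §1 THE CRUX IN THE NEW CONE.  `smoothPoincare4_of_cone : X₁ → X₂ → E → SPC4` and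
  `crux_iff_smoothPoincare4_of_cone : X₁ → X₂ → (E ↔ SPC4)`; `crux_iff_smoothPoincare4_of_rungTwo : R → (E ↔ SPC4)` and
  `crux_and_rungTwo_iff_smoothPoincare4 : (E ∧ R) ↔ SPC4` re-certified WITHOUT the route's `closes` (the landed file
  `Theorems/CylinderEntropyThinCrossSectionExistsIffSummit.lean` applies the OLD two-binder `closes` and no longer
  elaborates against rev 8 — checked 2026-08-17, `lean check` rc 1, five `Application type mismatch … closes h.right`).
* §2 STRENGTHEN = THE EXISTENCE LADDER `c ↦ ThinAtLevel c`.  `crux_iff_thinAtLevel : E ↔ ThinAtLevel (4/e)` (`Iff.rfl`),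
  monotonicity, `¬ ThinAtLevel c` for `c ≤ 1` (landed entropy floor), and the two rungs BELOW the crux:
  - rung `1 + ε`: `ENearSlice` (thin at every level `> 1`) with `smoothPoincare4_of_eNearSlice : ENearSlice → X₂ → SPC4`
    — the surgery crux X₁ is NOT used — and `eNearSlice_of_smoothPoincare4 : SPC4 → ENearSlice`,
    `crux_of_eNearSlice : ENearSlice → E`; so `ENearSlice ⟺ SPC4` modulo X₂ alone (`eNearSlice_iff_smoothPoincare4`);
  - rung `1` (attained, with a unit normal): `EUnitNormalLeOne` with `smoothPoincare4_of_eUnitNormalLeOne : EUnitNormalLeOne → SPC4`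
    OUTRIGHT, by the landed rigidity of rung one (`helper_sliceOfCylEntropyLeOne`: `λ_cyl ≤ 1` ⇒ slice) and
    `nonempty_diffeomorph_of_range_eq` (equal images ⇒ diffeomorphic domains).
  Reading: lowering the existence threshold from `4/e` to `1 + ε` deletes X₁ from the cone, lowering it to `1` deletes X₂ as
  well; at every threshold the existence statement is the summit modulo exactly the (SPC4-free) recognition theory available
  at that threshold.
* §3 DECOMPOSITION — the CORK SPLIT `E ⇐ CorkPresentation ∧ ThinForCorkTwists`.  `CorkPresentation` is the conclusion of the
  tree theorem `HomotopySphere.exists_isCorkTwist_sphere_of_facts` (Θ₄ = 0 + Matveyev/CFHS, both named facts), so it is a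
  theorem-from-facts (`corkPresentation_of_facts`); the glue `crux_of_splitCork` is PROVED; and the costume certificate
  `thinForCorkTwists_of_smoothPoincare4 : SPC4 → ThinForCorkTwists`,
  `smoothPoincare4_of_splitCork : R → CorkPresentation → ThinForCorkTwists → SPC4` shows the hard piece is the summit modulo
  R and the two facts — it is route PscCorkFillIn's carrier wearing this crux's badge.

Nothing here is new mathematics; each census entry names a checked Prop and a checked implication.
-/

noncomputable section

open scoped BigOperators Topology Manifold MeasureTheory ENNReal NNReal ContDiff ContinuousMap
open Set Function MeasureTheory
open Literature.Geometry.Riemannian.SphericalCylinderEntropy (cylEntropy)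
open Literature.Geometry.Manifold.CylinderSlice (sliceMap range_sliceMap isSmoothEmbedding_sliceMap sum_sq_sliceMap
  separatesEnds_of_slice_subset)

set_option linter.dupNamespace false

namespace Summit.SmoothPoincare4.SmoothPoincare4.Cruxes.ThinCrossSectionExists.StrategyCensusS1

open Summit.SmoothPoincare4.SmoothPoincare4.Theses.CylinderEntropy (ThinCrossSectionExists CylinderRungTwo
  CylinderSurgeryResolution NearSliceRecognition RungTwoOfSurgeryResolution closes)
open Summit.SmoothPoincare4.SmoothPoincare4.Theorems (RungTwoOfSurgeryResolution_proof cylEntropy_slice₀_le_one)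
open Summit.SmoothPoincare4.SmoothPoincare4.Theorems.ThinCrossSectionExists (BallMassSlack.crux_of_smoothPoincare4
  Negative.one_lt_level Negative.false_at_threshold_le_one)
open Literature.Topology.FourManifolds (HomotopySphere BoundaryData IsCorkTwist isHCobordant_sphere_of_homotopySphere_four
  Matveyev1996_decomposition compactSpace_of_homotopyEquiv_sphere_four_holds isOrientable_of_homotopyEquiv_sphere_four_holds
  pathConnectedSpace_sphere_four pathConnectedSpace_of_homotopyEquiv simplyConnectedSpace_of_homotopyEquiv_sphere_four
  simplyConnectedSpace_sphere_four_holds)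

local notation "E⁶" => EuclideanSpace ℝ (Fin 6)
local notation "E⁴" => EuclideanSpace ℝ (Fin 4)
local notation "𝕊⁴" => (Metric.sphere (0 : EuclideanSpace ℝ (Fin 5)) 1)

/-! ## §0 Vocabulary (verbatim sub-expressions of the item; same as `StrategyCensusSplits.lean`) -/

/-- `z ∈ N = S⁴×ℝ ⊂ ℝ⁶`, literally as in the items. -/
def InN (z : E⁶) : Prop := ∑ i : Fin 5, z (Fin.castSucc i) ^ 2 = 1

/-- "separates the two ends of `N`", literally as in the items. -/
def Separates (A : Set E⁶) : Prop :=
  ∃ R : ℝ, ∀ a b : E⁶, InN a → InN b → a 5 ≤ -R → R ≤ b 5 → ¬ JoinedIn ({z : E⁶ | InN z} \ A) a b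

/-- The bubble-sheet threshold `4/e` as typed. -/
def level : ℝ≥0∞ := ENNReal.ofReal (4 / Real.exp 1)

/-- `M` has an end-separating smooth cross-section embedding of typed cylinder entropy `< c`. -/
def CrossSectionBelow (c : ℝ≥0∞) (M : Type) [TopologicalSpace M] [ChartedSpace E⁴ M] : Prop :=
  ∃ ι : M → E⁶, Manifold.IsSmoothEmbedding (𝓡 4) (𝓡 6) ∞ ι ∧ (∀ x, InN (ι x)) ∧
    Separates (Set.range ι) ∧ cylEntropy (Set.range ι) < c

/-- **Existence at threshold `c`**: every homotopy 4-sphere of the bare frame is `CrossSectionBelow c`.  The crux E is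
`ThinAtLevel (4/e)`; the census's STRENGTHEN heading is the study of `c ↦ ThinAtLevel c` on `(1, 4/e]`. -/
def ThinAtLevel (c : ℝ≥0∞) : Prop :=
  ∀ (M : Type) [TopologicalSpace M] [T2Space M] [SecondCountableTopology M]
    [ChartedSpace E⁴ M] [IsManifold (𝓡 4) ∞ M], M ≃ₕ 𝕊⁴ → CrossSectionBelow c M

/-- E is literally `ThinAtLevel (4/e)`. -/
theorem crux_iff_thinAtLevel : ThinCrossSectionExists ↔ ThinAtLevel level := Iff.rfl

/-- Monotonicity of the ladder. -/
theorem thinAtLevel_mono {c c' : ℝ≥0∞} (h : c ≤ c') (hc : ThinAtLevel c) : ThinAtLevel c' := by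
  intro M _ _ _ _ _ e
  obtain ⟨ι, h1, h2, h3, h4⟩ := hc M e
  exact ⟨ι, h1, h2, h3, lt_of_lt_of_le h4 h⟩

/-- The ladder is EMPTY at and below `c = 1` (landed entropy floor `λ_cyl ≥ 1`, `Negative.false_at_threshold_le_one`). -/
theorem not_thinAtLevel_of_le_one {c : ℝ≥0∞} (hc : c ≤ 1) : ¬ ThinAtLevel c :=
  fun h => Negative.false_at_threshold_le_one hc (fun M _ _ _ _ _ e => h M e)

/-- `1 < 4/e` in the typed form. -/
theorem one_lt_level : (1 : ℝ≥0∞) < level := Negative.one_lt_level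

/-- **Pointwise slice lemma at every level `> 1`**: a manifold diffeomorphic to `S⁴` is `CrossSectionBelow c` for every
`c > 1` — the slice transported along the diffeomorphism has `λ_cyl ≤ 1` (landed `cylEntropy_slice₀_le_one`). -/
theorem crossSectionBelow_of_diffeomorph {c : ℝ≥0∞} (hc : 1 < c) {M : Type} [TopologicalSpace M] [ChartedSpace E⁴ M]
    [IsManifold (𝓡 4) ∞ M] (φ : M ≃ₘ⟮𝓡 4, 𝓡 4⟯ 𝕊⁴) : CrossSectionBelow c M := by
  have hr : Set.range (sliceMap 0 ∘ φ) = Set.range (sliceMap 0) := by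
    ext z
    simp only [Set.mem_range, Function.comp_apply]
    constructor
    · rintro ⟨x, rfl⟩; exact ⟨φ x, rfl⟩
    · rintro ⟨y, rfl⟩; exact ⟨φ.symm y, by simp⟩
  refine ⟨sliceMap 0 ∘ φ, (isSmoothEmbedding_sliceMap 0).comp_diffeomorph φ, fun x => sum_sq_sliceMap 0 (φ x), ?_, ?_⟩
  · rw [hr, range_sliceMap]
    exact separatesEnds_of_slice_subset subset_rfl
  · rw [hr, range_sliceMap]
    exact lt_of_le_of_lt cylEntropy_slice₀_le_one hc

/-- Hence SPC4 fills the whole ladder above `1`. -/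
theorem thinAtLevel_of_smoothPoincare4 {c : ℝ≥0∞} (hc : 1 < c) (h : _root_.SmoothPoincare4) : ThinAtLevel c := by
  intro M _ _ _ _ _ e
  obtain ⟨φ⟩ := h M ‹ChartedSpace E⁴ M› ‹IsManifold (𝓡 4) ∞ M› e
  exact crossSectionBelow_of_diffeomorph hc φ

/-! ## §1 The crux in the NEW cone (route file rev 8) -/

/-- **`R → E → SPC4` directly** (no `closes`): R recognises the thin cross-section that E supplies. -/
theorem smoothPoincare4_of_rungTwo_of_crux (hR : CylinderRungTwo) (hE : ThinCrossSectionExists) :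
    _root_.SmoothPoincare4 := by
  unfold _root_.SmoothPoincare4 Literature.SPC4.SmoothPoincareConjectureFour
    ContinuousMap.HomotopyEquiv.NonemptyDiffeomorphSphere
  intro M _ _ _ _ _ e
  obtain ⟨ι, hι, hN, hsep, hlt⟩ := hE M e
  exact hR M e ι hι hN hsep hlt

/-- **E ⟺ SPC4 modulo R**, re-certified for rev 8 without `closes` (`⇐` is the landed calibration-free
`BallMassSlack.crux_of_smoothPoincare4`). -/
theorem crux_iff_smoothPoincare4_of_rungTwo (hR : CylinderRungTwo) : ThinCrossSectionExists ↔ _root_.SmoothPoincare4 :=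
  ⟨smoothPoincare4_of_rungTwo_of_crux hR, BallMassSlack.crux_of_smoothPoincare4⟩

/-- **`(E ∧ R) ⟺ SPC4`, no hypothesis** (re-certified; `R ⇐ SPC4` is trivial). -/
theorem crux_and_rungTwo_iff_smoothPoincare4 : (ThinCrossSectionExists ∧ CylinderRungTwo) ↔ _root_.SmoothPoincare4 := by
  refine ⟨fun h => smoothPoincare4_of_rungTwo_of_crux h.2 h.1, fun h => ⟨BallMassSlack.crux_of_smoothPoincare4 h, ?_⟩⟩
  intro M _ _ _ _ _ e _ _ _ _ _
  exact h M ‹ChartedSpace E⁴ M› ‹IsManifold (𝓡 4) ∞ M› e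

/-- **The new cone, literally**: `X₁ → X₂ → E → SPC4` is the route's `closes` with its third binder discharged by the landed
`RungTwoOfSurgeryResolution_proof`. -/
theorem smoothPoincare4_of_cone (hX₁ : CylinderSurgeryResolution) (hX₂ : NearSliceRecognition) (hE : ThinCrossSectionExists) :
    _root_.SmoothPoincare4 :=
  closes hX₁ hX₂ RungTwoOfSurgeryResolution_proof hE

/-- **E ⟺ SPC4 modulo the new cone's other binders `X₁ ∧ X₂`** (both SPC4-free analysis, neither implied by SPC4):
the cone change re-routes R through `X₁ ∧ X₂` and leaves E exactly where it was — the route's SPC4-carrier. -/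
theorem crux_iff_smoothPoincare4_of_cone (hX₁ : CylinderSurgeryResolution) (hX₂ : NearSliceRecognition) :
    ThinCrossSectionExists ↔ _root_.SmoothPoincare4 :=
  ⟨smoothPoincare4_of_cone hX₁ hX₂, BallMassSlack.crux_of_smoothPoincare4⟩

/-- So in the new cone a refutation of E is still exactly an exotic `S⁴`. -/
theorem not_crux_iff_not_smoothPoincare4_of_cone (hX₁ : CylinderSurgeryResolution) (hX₂ : NearSliceRecognition) :
    ¬ ThinCrossSectionExists ↔ ¬ _root_.SmoothPoincare4 :=
  not_congr (crux_iff_smoothPoincare4_of_cone hX₁ hX₂)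

/-- **Any supply line saturates at the summit**: a statement `D` with a proof `D → E` gives, with the cone's other binders,
`D → SPC4`; so the hardest stub of every line for E is SPC4-strength for the class of spheres it covers (ball-mass-slack:
`D = stub_massSlackIntr`, landed `stub_massSlackIntr_iff_smoothPoincare4`). -/
theorem supply_saturates {D : Prop} (hD : D → ThinCrossSectionExists) (hX₁ : CylinderSurgeryResolution)
    (hX₂ : NearSliceRecognition) : D → _root_.SmoothPoincare4 :=
  fun d => smoothPoincare4_of_cone hX₁ hX₂ (hD d)

/-! ## §2 STRENGTHEN — the existence ladder below the crux -/

/-- **Rung `1 + ε` (near-slice existence)**: every homotopy 4-sphere has, for EVERY `ε > 0`, an end-separating smooth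
cross-section of cylinder entropy `< 1 + ε`.  (The `∀ ε` is forced: X₂'s `ε` is existential and unknown.) -/
def ENearSlice : Prop := ∀ ε : ℝ, 0 < ε → ThinAtLevel (ENNReal.ofReal (1 + ε))

/-- `ENearSlice → E` (take `ε = 4/e − 1 > 0`). -/
theorem crux_of_eNearSlice (h : ENearSlice) : ThinCrossSectionExists := by
  rw [crux_iff_thinAtLevel]
  have hε : 0 < 4 / Real.exp 1 - 1 := by
    rw [sub_pos, lt_div_iff₀ (Real.exp_pos 1)]
    have := Real.exp_one_lt_d9
    linarith
  have := h (4 / Real.exp 1 - 1) hε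
  rwa [show (1 : ℝ) + (4 / Real.exp 1 - 1) = 4 / Real.exp 1 by ring] at this

/-- `SPC4 → ENearSlice` (the slice has `λ_cyl ≤ 1 < 1 + ε`). -/
theorem eNearSlice_of_smoothPoincare4 (h : _root_.SmoothPoincare4) : ENearSlice := by
  intro ε hε
  refine thinAtLevel_of_smoothPoincare4 ?_ h
  rw [← ENNReal.ofReal_one]
  exact (ENNReal.ofReal_lt_ofReal_iff (by linarith)).mpr (by linarith)

/-- **`ENearSlice → X₂ → SPC4` — the surgery crux X₁ is not used.**  A homotopy 4-sphere is compact, connected and simply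
connected (tree facts); X₂ recognises its near-slice cross-section (X₂ carries no separation hypothesis). -/
theorem smoothPoincare4_of_eNearSlice (hE : ENearSlice) (hX₂ : NearSliceRecognition) : _root_.SmoothPoincare4 := by
  obtain ⟨ε, hε, hrec⟩ := hX₂
  unfold _root_.SmoothPoincare4 Literature.SPC4.SmoothPoincareConjectureFour
    ContinuousMap.HomotopyEquiv.NonemptyDiffeomorphSphere
  intro M _ _ _ _ _ e
  haveI : CompactSpace M := compactSpace_of_homotopyEquiv_sphere_four_holds M e
  haveI : PathConnectedSpace M := by
    haveI := pathConnectedSpace_sphere_four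
    exact pathConnectedSpace_of_homotopyEquiv e
  have hsc : SimplyConnectedSpace M :=
    simplyConnectedSpace_of_homotopyEquiv_sphere_four simplyConnectedSpace_sphere_four_holds M e
  obtain ⟨ι, hι, hN, -, hlt⟩ := hE ε hε M e
  exact hrec M hsc ι hι hN hlt

/-- **`ENearSlice ⟺ SPC4` modulo X₂ alone.**  Strengthening E from threshold `4/e` to the near-slice threshold removes the
surgery crux X₁ from the cone: X₁'s entire role in the route is to lower the EXISTENCE threshold from `1 + ε` to `4/e`. -/
theorem eNearSlice_iff_smoothPoincare4 (hX₂ : NearSliceRecognition) : ENearSlice ↔ _root_.SmoothPoincare4 :=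
  ⟨fun h => smoothPoincare4_of_eNearSlice h hX₂, eNearSlice_of_smoothPoincare4⟩

/-- **Rung `1` (attained, with a unit normal)**: every compact connected homotopy 4-sphere of the frame has an end-separating
smooth cross-section embedding carrying a continuous unit normal field tangent to `N`, of cylinder entropy `≤ 1`.  (At
`c = 1` the strict ladder is empty, `not_thinAtLevel_of_le_one`; this is the closed rung, typed with exactly the hypotheses
of the landed rigidity lemma `helper_sliceOfCylEntropyLeOne`.) -/
def EUnitNormalLeOne : Prop :=
  ∀ (M : Type) [TopologicalSpace M] [T2Space M] [SecondCountableTopology M]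
    [ChartedSpace E⁴ M] [IsManifold (𝓡 4) ∞ M] [CompactSpace M] [ConnectedSpace M] [MeasurableSpace M] [BorelSpace M],
    M ≃ₕ 𝕊⁴ → ∃ (ι : M → E⁶) (ν : M → E⁶), Manifold.IsSmoothEmbedding (𝓡 4) (𝓡 6) ∞ ι ∧ (∀ x, InN (ι x)) ∧
      Separates (Set.range ι) ∧ Continuous ν ∧
      (Literature.Geometry.Riemannian.euclideanMetric E⁶).IsUnitNormal (𝓡 4) ι ν 1 ∧
      (∀ x, ∑ i : Fin 5, ν x (Fin.castSucc i) * ι x (Fin.castSucc i) = 0) ∧ cylEntropy (Set.range ι) ≤ 1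

/-- **`EUnitNormalLeOne → SPC4` OUTRIGHT** (no recognition crux): by the landed rigidity of rung one the cross-section IS a
slice `S⁴ × {c}` (`helper_sliceOfCylEntropyLeOne`), and two smooth embeddings with the same image have diffeomorphic
domains (`nonempty_diffeomorph_of_range_eq`, Lee Cor. 5.30).  So the bottom rung of the existence ladder is the summit
modulo LANDED theorems: the lower the threshold, the less recognition theory E needs to become SPC4, and at no threshold in
`[1, 4/e]` is the existence statement known other than through SPC4. -/
theorem smoothPoincare4_of_eUnitNormalLeOne (h : EUnitNormalLeOne) : _root_.SmoothPoincare4 := by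
  unfold _root_.SmoothPoincare4 Literature.SPC4.SmoothPoincareConjectureFour
    ContinuousMap.HomotopyEquiv.NonemptyDiffeomorphSphere
  intro M _ _ _ _ _ e
  haveI : CompactSpace M := compactSpace_of_homotopyEquiv_sphere_four_holds M e
  haveI : PathConnectedSpace M := by
    haveI := pathConnectedSpace_sphere_four
    exact pathConnectedSpace_of_homotopyEquiv e
  letI : MeasurableSpace M := borel M
  haveI : BorelSpace M := ⟨rfl⟩
  obtain ⟨ι, ν, hι, hN, ⟨R, hR⟩, hνc, hνn, hνN, hent⟩ := h M e
  obtain ⟨c, hc⟩ :=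
    Summit.SmoothPoincare4.SmoothPoincare4.Cruxes.CylinderRungTwo.KillingFlux.helper_sliceOfCylEntropyLeOne M ι hι hN
      ⟨R, hR⟩ ν hνc hνn hνN hent
  exact Literature.Geometry.Manifold.nonempty_diffeomorph_of_range_eq hι (isSmoothEmbedding_sliceMap c) hc

/-! ## §3 DECOMPOSITION — the cork split `E ⇐ CorkPresentation ∧ ThinForCorkTwists` -/

/-- `S` is a cork twist of `S⁴` along a compact contractible `C` — the conclusion of the tree theorem
`HomotopySphere.exists_isCorkTwist_sphere_of_facts`, verbatim. -/
def CorkPresented (S : HomotopySphere 4) : Prop :=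
  ∃ (C : Type) (_ : TopologicalSpace C) (_ : T2Space C) (_ : SecondCountableTopology C)
    (_ : ChartedSpace (EuclideanHalfSpace 4) C) (_ : IsManifold (𝓡∂ 4) ∞ C)
    (bC : BoundaryData (𝓡∂ 4) C (𝓡 3)) (τ : bC.carrier ≃ₘ⟮𝓡 3, 𝓡 3⟯ bC.carrier),
    CompactSpace C ∧ ContractibleSpace C ∧ IsCorkTwist bC τ (𝓡 4) 𝕊⁴ (𝓡 4) S.carrier

/-- Piece 1 of the cork split: every homotopy 4-sphere is cork-presented. -/
def CorkPresentation : Prop := ∀ S : HomotopySphere 4, CorkPresented S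

/-- **Piece 1 is a theorem-from-facts** (Θ₄ = 0, Kervaire–Milnor; cork decomposition, Matveyev 1996 / CFHS 1996 — both named
facts of the tree): `HomotopySphere.exists_isCorkTwist_sphere_of_facts`. -/
theorem corkPresentation_of_facts (hΘ : isHCobordant_sphere_of_homotopySphere_four) (hM : Matveyev1996_decomposition.{0}) :
    CorkPresentation :=
  fun S => HomotopySphere.exists_isCorkTwist_sphere_of_facts hΘ hM S

/-- Piece 2 of the cork split (the hard half): every cork-presented homotopy 4-sphere has a thin cross-section. -/
def ThinForCorkTwists : Prop := ∀ S : HomotopySphere 4, CorkPresented S → CrossSectionBelow level S.carrier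

/-- **Glue of the cork split** (packaging the bare frame as a `HomotopySphere 4` — compact by `H₄`, oriented by simple
connectivity — exactly as `Stabilisation.closes` does): `CorkPresentation → ThinForCorkTwists → E`. -/
theorem crux_of_splitCork (h1 : CorkPresentation) (h2 : ThinForCorkTwists) : ThinCrossSectionExists := by
  rw [crux_iff_thinAtLevel]
  intro M _ _ _ _ _ e
  haveI : CompactSpace M := compactSpace_of_homotopyEquiv_sphere_four_holds M e
  let S : HomotopySphere 4 :=
    { carrier := M
      orientation := Classical.choice (isOrientable_of_homotopyEquiv_sphere_four_holds M e)
      nonempty_homotopyEquiv := ⟨e⟩ }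
  exact h2 S (h1 S)

/-- **Costume certificate, direction 1**: SPC4 gives the hard half outright (slice through the diffeomorphism). -/
theorem thinForCorkTwists_of_smoothPoincare4 (h : _root_.SmoothPoincare4) : ThinForCorkTwists := by
  intro S _
  obtain ⟨φ⟩ := h S.carrier S.chartedSpace S.isManifold (Classical.choice S.nonempty_homotopyEquiv)
  exact crossSectionBelow_of_diffeomorph one_lt_level φ

/-- **Costume certificate, direction 2**: modulo R and the two presentation facts the hard half gives SPC4.  So
`ThinForCorkTwists ⟺ SPC4` modulo (R, Θ₄ = 0, Matveyev): the cork split decomposes the SUMMIT along route PscCorkFillIn's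
factorisation (presentation ∧ "every cork twist of `S⁴` is standard"), not the crux. -/
theorem smoothPoincare4_of_splitCork (hR : CylinderRungTwo) (hΘ : isHCobordant_sphere_of_homotopySphere_four)
    (hM : Matveyev1996_decomposition.{0}) (h2 : ThinForCorkTwists) : _root_.SmoothPoincare4 :=
  smoothPoincare4_of_rungTwo_of_crux hR (crux_of_splitCork (corkPresentation_of_facts hΘ hM) h2)

/-- The same modulo the new cone's binders instead of R. -/
theorem smoothPoincare4_of_splitCork_of_cone (hX₁ : CylinderSurgeryResolution) (hX₂ : NearSliceRecognition)
    (hΘ : isHCobordant_sphere_of_homotopySphere_four) (hM : Matveyev1996_decomposition.{0}) (h2 : ThinForCorkTwists) :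
    _root_.SmoothPoincare4 :=
  smoothPoincare4_of_cone hX₁ hX₂ (crux_of_splitCork (corkPresentation_of_facts hΘ hM) h2)

/-! ## §4 DECOMPOSITION — the threshold split `E ⇐ ThinAtLevel c₀ ∧ Gap c₀` and why its gap piece is E -/

/-- The gap piece of a threshold split at `c₀ ≥ 4/e`: thinning from `< c₀` to `< 4/e`. -/
def Gap (c₀ : ℝ≥0∞) : Prop := ThinAtLevel c₀ → ThinAtLevel level

/-- Glue of the threshold split (modus ponens). -/
theorem crux_of_thresholdSplit {c₀ : ℝ≥0∞} (h0 : ThinAtLevel c₀) (hg : Gap c₀) : ThinCrossSectionExists :=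
  crux_iff_thinAtLevel.mpr (hg h0)

/-- **The gap piece is E modulo its own easy half**: whenever the upper rung `ThinAtLevel c₀` is a theorem (the census argues
it is SPC4-free for `c₀ > λ(S¹×ℝ³)`, EntropyLadder's unproved `TopRungBound`), `Gap c₀ ↔ E`. -/
theorem gap_iff_crux {c₀ : ℝ≥0∞} (h0 : ThinAtLevel c₀) : Gap c₀ ↔ ThinCrossSectionExists :=
  ⟨fun hg => crux_of_thresholdSplit h0 hg, fun hE _ => crux_iff_thinAtLevel.mp hE⟩

end Summit.SmoothPoincare4.SmoothPoincare4.Cruxes.ThinCrossSectionExists.StrategyCensusS1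

end
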